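import Literature.AlgebraicGeometry.Resolution.RegularCentreBlowupOrder

/-!
# StellarCut T10c — «NearPoint»: [CoP1] Prop. 4.2 (11)/(a) in SHARP form — the order of the weak transform read off
# the FIBRE POLYNOMIAL, for a GIVEN form in GIVEN centre parameters (lens-6, g32 → g33 tool; 0-weight)

`Literature…RegularCentreBlowupOrder` ([CoP1] = Cossart–Piltant 2008, proof of Prop. 4.2) bounds the order of the weak
(controlled) transform `J' = (J𝒪_{X'} : 𝓘_E^μ)` at every point `x'` over a regular centre by the DEGREE `μ`, choosing
internally quasi-regular generators `c` of the centre stalk and an `f = F(c) ∈ J_x` of order `μ`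
(`eval₂Hom_chartGen_not_mem_maximalIdeal_pow_of_le`, `IsBlowup.not_stalkIdeal_controlledTransform_le_pow_of_mem`).  The
«TameCut» round lemma (`DeltaCutStellarTame`, residue `p ∤ n`) needs the same argument with the frame parameters
`c = (h, z_T)` and the form `F = Y_Hⁿ + coef·Y^b` (`f = hⁿ + u·m`) as INPUTS and with the degree bound replaced by the ORDER
OF THE FIBRE POLYNOMIAL `g = F̄(T_j := 1) ∈ κ(x)[T_l : l ≠ j]` at the prime of `x'` — required only at the primes avoiding
the variables `T_l`, `l ∈ S`, provided the parameters `c_l`, `l ∈ S`, generate the exceptional ideal at `x'` (`S = {H}`: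
`x'` off the strict transform `H'`).  With `e = 2` and the guards of `DeltaCutStellarGuard` (`g = 1 + c̄·ΠT_l^{a_l}`:
order `≤ 1` at every prime when some `a_l` is invertible in `κ`) this gives order `≤ 1 < n` at EVERY point of the
exceptional fibre off `H'`, rational or not — no residue-field hypothesis anywhere (critic's pre-ruling 222q (h2)).

* `eval₂Hom_chartGen_notMem_maximalIdeal_pow_of_fibre` — CHART LEVEL ([CoP1] (11) sharp): `R` local, `c` quasi-regular in
  `𝔪_R`, any `F ∈ R[Y]`, `e`, `S`; if `F̄(T_j := 1) ∉ 𝔪_𝔮^e κ[T]_𝔮` at every prime `𝔮` of `κ[T_l : l ≠ j]` avoiding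
  `{T_l : l ∈ S}`, then `F(e) ∉ 𝔪_𝔴^e (B_j)_𝔴` at every prime `𝔴 ⊇ 𝔪B_j` at which the generators `e_l`, `l ∈ S`, are units
  (chart residue map `ρ : B_j ↠ κ[T]` of `exists_chartResidueMap`, `ρ(F(e)) = F̄(T_j := 1)`, `ρ(e_l) = T_l`, and the
  local homomorphism `(B_j)_𝔴 → κ[T]_{ρ(𝔴)}`, `PointBlowupOrderChart.algebraMap_not_mem_maximalIdeal_pow_of_comap_eq`);
* `IsBlowup.not_stalkIdeal_controlledTransform_le_pow_of_fibre` — SCHEME LEVEL ([CoP1] (a) sharp): for ANY blow-up `π`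
  along `C` (`IsBlowup π C`), a point `x'`, quasi-regular `c` in `𝔪_{π x'}` generating `C_{π x'}`, a form `F` of degree
  `μ` with `F(c) ∈ J_{π x'}`, `e` and `S`: if `c_l𝒪_{X',x'} = C𝒪_{X',x'}` for `l ∈ S` and the chart-level hypothesis holds
  on every chart `j`, then **`J'_{x'} ⊄ 𝔪_{x'}^e`** (stalk-chart presentation `IsBlowup.exists_reesChart_stalk`,
  `𝒪_{X',x'} = (B_j)_𝔴`; the `c_l`, `l ∈ S`, are units at `𝔴` because `φ(c_j)` is a non-zero-divisor,
  `reesChartBase_mem_nonZeroDivisors`).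

No regularity, order or residue-field hypotheses.  PROVED over the Literature; [cite: CossartPiltant2008, proof of
Prop. 4.2, (11) and (a)] for the method.
-/

namespace Summit.ResolutionOfSingularities.ResolutionOfSingularities.Theorems.DeltaCutClasses

open CategoryTheory AlgebraicGeometry TopologicalSpace IsLocalRing MvPolynomial
open Literature.AlgebraicGeometry.Resolution
open Scheme.IdealSheafData

universe u

section Chart

/-- **[CoP1] (11), sharp form: the order of the weak transform on a chart is bounded by the order of the fibre
polynomial.**  `R` local, `c` quasi-regular in `𝔪_R`, `F ∈ R[Y]`, `𝔴 ⊇ 𝔪B_j` a prime of the chart ring at which the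
generators `e_l` (`l ∈ S`) are units; if `F̄(T_j := 1) ∉ 𝔪_𝔮^e` at every prime `𝔮` of `κ[T_l : l ≠ j]` avoiding the
variables indexed by `S`, then `F(e) ∉ 𝔪_𝔴^e`. [cite: CossartPiltant2008, proof of Prop. 4.2, (11)] -/
theorem eval₂Hom_chartGen_notMem_maximalIdeal_pow_of_fibre {R : Type u} [CommRing R] [IsLocalRing R] {k : ℕ}
    (c : Fin k → R) (j : Fin k) (hcq : IsQuasiRegular c) (hcm : ∀ l, c l ∈ maximalIdeal R)
    (F : MvPolynomial (Fin k) R) (e : ℕ) (S : Set {l : Fin k // l ≠ j})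
    (hg : ∀ (𝔮 : Ideal (MvPolynomial {l : Fin k // l ≠ j} (R ⧸ maximalIdeal R))) [𝔮.IsPrime],
      (∀ l ∈ S, (X l : MvPolynomial {l : Fin k // l ≠ j} (R ⧸ maximalIdeal R)) ∉ 𝔮) →
        algebraMap _ (Localization.AtPrime 𝔮)
            (MvPolynomial.map (Ideal.Quotient.mk (maximalIdeal R)) (dehomogenize j F)) ∉
          maximalIdeal (Localization.AtPrime 𝔮) ^ e)
    (𝔴 : Ideal (chartRing c j)) [𝔴.IsPrime] (h𝔴 : (maximalIdeal R).map (chartBase c j) ≤ 𝔴)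
    (hS : ∀ l ∈ S, chartGen c j l.1 ∉ 𝔴) :
    (algebraMap (chartRing c j) (Localization.AtPrime 𝔴) :
        chartRing c j →+* Localization.AtPrime 𝔴)
        (MvPolynomial.eval₂Hom (chartBase c j) (fun l => chartGen c j l) F) ∉
      maximalIdeal (Localization.AtPrime 𝔴) ^ e := by
  classical
  intro hmem
  obtain ⟨ρ, hρsurj, hρker, hρF⟩ := exists_chartResidueMap c j hcq hcm
  -- the prime `𝔮 = ρ(𝔴)` of the fibre and `𝔴 = ρ⁻¹(𝔮)`
  have hker : RingHom.ker ρ ≤ 𝔴 := hρker.trans_le h𝔴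
  haveI h𝔮 : (𝔴.map ρ).IsPrime := Ideal.map_isPrime_of_surjective hρsurj hker
  have hcomap : 𝔴 = (𝔴.map ρ).comap ρ := by
    rw [Ideal.comap_map_of_surjective ρ hρsurj, ← RingHom.ker_eq_comap_bot, sup_eq_left.mpr hker]
  -- `ρ(e_l) = T_l`, so `𝔮` avoids the variables indexed by `S`
  have hXS : ∀ l ∈ S, (X l : MvPolynomial {l : Fin k // l ≠ j} (R ⧸ maximalIdeal R)) ∉ 𝔴.map ρ := by
    intro l hl hX
    have hgen : ρ (chartGen c j l.1) = X l := by
      have h1 := hρF (X l.1)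
      rw [MvPolynomial.coe_eval₂Hom, MvPolynomial.eval₂_X] at h1
      rw [h1, MvPolynomial.aeval_X, killVar_of_ne j l.2, MvPolynomial.map_X]
    apply hS l hl
    rw [hcomap, Ideal.mem_comap, hgen]
    exact hX
  have hb := hg (𝔴.map ρ) hXS
  rw [← hρF] at hb
  exact algebraMap_not_mem_maximalIdeal_pow_of_comap_eq ρ 𝔴 (𝔴.map ρ) hcomap hb hmem

end Chart

section SchemeLevel

variable {X X' : Scheme.{u}} {π : X' ⟶ X}

set_option maxHeartbeats 400000 in
/-- **[CoP1] Prop. 4.2 (a), sharp form with the centre parameters and the form as inputs.**  See the module docstring.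
[cite: CossartPiltant2008, proof of Prop. 4.2 (a)] -/
theorem IsBlowup.not_stalkIdeal_controlledTransform_le_pow_of_fibre [IsLocallyNoetherian X] [IsLocallyNoetherian X']
    {C J : X.IdealSheafData} (hπ : IsBlowup π C) {μ : ℕ} {x' : X'} {k : ℕ}
    (c : Fin k → X.presheaf.stalk (π x')) (hcspan : Ideal.span (Set.range c) = stalkIdeal C (π x'))
    (hcq : IsQuasiRegular c) (hcm : ∀ l, c l ∈ maximalIdeal (X.presheaf.stalk (π x')))
    {F : MvPolynomial (Fin k) (X.presheaf.stalk (π x'))} (hF : F.IsHomogeneous μ)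
    (hFJ : MvPolynomial.eval c F ∈ stalkIdeal J (π x')) (e : ℕ) (S : Set (Fin k))
    (hS : ∀ l ∈ S, (stalkIdeal C (π x')).map (π.stalkMap x').hom = Ideal.span {(π.stalkMap x').hom (c l)})
    (hg : ∀ (j : Fin k) (𝔮 : Ideal (MvPolynomial {l : Fin k // l ≠ j}
        (X.presheaf.stalk (π x') ⧸ maximalIdeal (X.presheaf.stalk (π x'))))) [𝔮.IsPrime],
      (∀ l : {l : Fin k // l ≠ j}, l.1 ∈ S → (MvPolynomial.X l : MvPolynomial {l : Fin k // l ≠ j}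
          (X.presheaf.stalk (π x') ⧸ maximalIdeal (X.presheaf.stalk (π x')))) ∉ 𝔮) →
        algebraMap _ (Localization.AtPrime 𝔮)
            (MvPolynomial.map (Ideal.Quotient.mk (maximalIdeal (X.presheaf.stalk (π x'))))
              (dehomogenize j F)) ∉ maximalIdeal (Localization.AtPrime 𝔮) ^ e) :
    ¬ stalkIdeal (controlledTransform π C J μ) x' ≤ maximalIdeal (X'.presheaf.stalk x') ^ e := by
  classical
  intro hle
  -- the chart presentation `𝒪_{X',x'} = (B_j)_𝔴`, `𝔴 ⊇ 𝔪 B_j`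
  obtain ⟨j, 𝔴, χ, hχ, hloc, h𝔴⟩ := hπ.exists_reesChart_stalk x' c hcspan
  letI := χ.toAlgebra
  haveI : IsLocalization.AtPrime (X'.presheaf.stalk x') 𝔴.asIdeal := hloc
  have h𝔴' : (maximalIdeal _).map (chartBase c j) ≤ 𝔴.asIdeal := by
    rw [← h𝔴]
    exact Ideal.map_comap_le
  have hff' := reesChartBase_eval_eq_pow_mul_eval₂ c j hF
  have hu : ∀ l, (π.stalkMap x').hom (c l) = (π.stalkMap x').hom (c j) * χ (chartGen c j l) :=
    fun l => by rw [← hχ, ← hχ, ← map_mul, ← reesChartBase_apply_eq_mul_chartGen c j l]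
  have hCmap : (stalkIdeal C (π x')).map (π.stalkMap x').hom = Ideal.span {χ (chartBase c j (c j))} := by
    rw [← hcspan, Ideal.map_span_range_eq_span_singleton _ c j _ hu, ← hχ]
  -- the generators indexed by `S` are units at `𝔴`
  have hnzd : χ (chartBase c j (c j)) ∈ nonZeroDivisors (X'.presheaf.stalk x') :=
    IsLocalization.nonZeroDivisors_le_comap 𝔴.asIdeal.primeCompl (X'.presheaf.stalk x')
      (reesChartBase_mem_nonZeroDivisors (c j) (Ideal.mem_span_range_self (f := c) (x := j)))
  have hSw : ∀ l : {l : Fin k // l ≠ j}, l.1 ∈ S → chartGen c j l.1 ∉ 𝔴.asIdeal := by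
    intro l hl
    have h1 : χ (chartBase c j (c j)) ∈
        Ideal.span {(π.stalkMap x').hom (c j) * χ (chartGen c j l.1)} := by
      rw [← hu, ← hS l.1 hl, hCmap]
      exact Ideal.mem_span_singleton_self _
    obtain ⟨r, hr⟩ := Ideal.mem_span_singleton'.mp h1
    rw [← hχ] at hr
    have h2 : χ (chartBase c j (c j)) * (r * χ (chartGen c j l.1)) = χ (chartBase c j (c j)) * 1 := by
      rw [mul_one]
      conv_rhs => rw [← hr]
      ring
    have h3 := (mul_cancel_left_mem_nonZeroDivisors hnzd).mp h2
    have hunit : IsUnit (χ (chartGen c j l.1)) := IsUnit.of_mul_eq_one r (by rw [mul_comm]; exact h3)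
    exact (IsLocalization.AtPrime.isUnit_to_map_iff (X'.presheaf.stalk x') 𝔴.asIdeal
      (chartGen c j l.1)).mp hunit
  -- the chart bound, from the fibre hypothesis (T10a)
  have hford := eval₂Hom_chartGen_notMem_maximalIdeal_pow_of_fibre c j hcq hcm F e
    {l : {l : Fin k // l ≠ j} | l.1 ∈ S} (fun 𝔮 _ h𝔮S => hg j 𝔮 fun l hl => h𝔮S l hl) 𝔴.asIdeal h𝔴'
    (fun l hl => hSw l hl)
  -- `χ F(e) ∈ J'_{x'}`
  have hmem : χ (MvPolynomial.eval₂Hom (chartBase c j) (fun l => chartGen c j l) F) ∈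
      stalkIdeal (controlledTransform π C J μ) x' := by
    rw [controlledTransform, stalkIdeal_colon, stalkIdeal_pow, stalkIdeal_comap_eq_map_stalkMap,
      stalkIdeal_comap_eq_map_stalkMap, hCmap]
    exact map_mem_colon_of_eq_pow_mul (chartBase c j) χ (π.stalkMap x').hom hχ hff' hFJ
  -- transport from `(B_j)_𝔴` to `𝒪_{X',x'}`
  exact algebraMap_not_mem_maximalIdeal_pow_of_isLocalization 𝔴.asIdeal hford (hle hmem)

end SchemeLevel

end Summit.ResolutionOfSingularities.ResolutionOfSingularities.Theorems.DeltaCutClasses
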